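/-
Copyright (c) 2026 the pub-hodgecm-mathlib formalisation cell (harness21).  Prover seat hodgecm-mathlib-K2E5-p12 (g0), K2-LIT, h413 = `stmt-HodgeConjecture-24833`, unit U3b,
sub-line «U3b-c RANK-ONE GERMS», (ii♭-H): FILE 3 of the rank-one twin of the ‹Ψ-package› — the export to `U(Φ₂)(L⁺_v)` and the head ‹SC₂-explicit› → ‹Ψ-package›₂
(DEAL K2E3-plan (g1), K2/STATUS.md 2026-09-03T23:27:26Z (b); REPORT-FIRST ED. 2 23:52:39Z).  2026-09-04.
-/
import Summits.HodgeConjecture.HodgeConjecture.Theorems.K2E3CayleyScalingRankOneMap   -- ★ FILE 2 (this seat, p855813): (C)(E)(Z)(R)(T)(S) on the model; brings ★ FILE 1 (p855742): the ball, `exists_cayleyScaling`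
import Summits.HodgeConjecture.HodgeConjecture.Theorems.K2E3CayleyScalingPackage      -- ★ K2E3-p01 (p855512): `isLocSmooth_comp_homeomorph` (generic; reused BY NAME)
import Summits.HodgeConjecture.HodgeConjecture.Theorems.F0P3cStCharTSCartanFinTwo     -- ★ `isRegularElt_iff_separable_localNonsplitEquiv_two` (regularity on both sides of the rank-2 one-place model)
import HarnessLib

/-!
# h413 ∕ K2-LIT, line `K2_E3_EllipticInputs`, unit U3b, (ii♭-H): THE RANK-ONE CAYLEY SCALING PACKAGE ON `U(Φ₂)(L⁺_v) = (cmDatum L 2 Φ₂).Local v` —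
# EXISTENCE, Ad-STABLE NEIGHBOURHOOD, EQUIVARIANCE, CENTRALISERS, REGULARITY, CONTRACTION, `C_c^∞`-PULL-BACK, AND THE HEAD ‹SC₂-explicit› → ‹Ψ-package›₂ (FILE 3)

Cell `pub/hodgecm-mathlib`, crux H413 = `stmt-HodgeConjecture-24833`; dealer K2E3-plan (g1), line lead (ii) K2E4-p06 (g2), consult K2E3-p01 (g0).  THEOREMS ONLY (no `def`, no
`instance`, no `notation`, no named-fact hypothesis, no `sorry`); lane `--supports stmt-HodgeConjecture-24833 --as helper` (count-neutral).  The `N = 2` twin of ★ K2E3-p01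
`K2E3CayleyScalingPackage.psiPackage_of_scalingLaw` (p855512), one rank lower, for the `U(Φ₂)`-factor of `H_v = U(Φ₂)(L⁺_v) × U(Φ₁)(L⁺_v)`
(`Φ₂ = Matrix.of fun i j : Fin 2 => if i.val + j.val + 1 = 2 then 1 else 0`; carrier `(UnitaryGroup.cmDatum L 2 Φ₂).Local v`, the spelling of U3b's sockets).

THE OBJECTS AT A NON-SPLIT PLACE (`w ∣ v`, `c̄w = w`, `e = localNonsplitEquiv : U(Φ₂)(L⁺_v) ≃ₜ* U(σ_w, Φ₂)(L_w)` ★, generic rank).  For `γ` write `g = mat(e γ)`, `X_γ = (g − 1)(g + 1)⁻¹`.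
The EIGENVALUE BALL of radius `ρ`: `U₀ = {γ | det(g + 1) ∈ L_wˣ ∧ ‖tr X_γ‖ ≤ ρ ∧ ‖det X_γ‖ ≤ ρ²}` (★ FILE 1, PAIR version); the CAYLEY SCALING `Ψ = e⁻¹ ∘ Ψ₀ ∘ e`, `Ψ₀` the
model scaling with `mat(Ψ₀ u) = c(s•X_u)` on the ball (★ FILE 1 `exists_cayleyScaling`), `s ∈ L_w` `σ_w`-fixed, `0 < ‖s‖ < 1`.

‹SC₂-explicit› (hypothesis `hSC`, the rank-one C-file's statement): at every non-split `v` there are `w, s, ρ, q, a` (`σ_w s = s`, `s ≠ 0`, `‖s‖ < 1`, `0 < ρ < 1`, `1 < ‖q‖`, `a u ≥ 1`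
off `[1]`) such that FOR EVERY pair `(Ψ, U₀)` consisting of the eigenvalue ball of radius `ρ` and a map agreeing with `c ∘ (s·) ∘ c⁻¹` on it (read at `w` through `e`), the SCALING
LAW `Φ_{mU}(u, 1_{U₀}·(F∘Ψ)) = q^{a u}·Φ_{mU}(u, F)` holds (unipotent `S`: `(g − 1)² = 0`; admissible `mU`; `F ∈ C_c^∞`).  CONCLUSION ‹Ψ-package›₂: such a pair exists with
(U1) `U₀ ∈ 𝓝 1`, (U2) Ad-stable, (E) equivariant, (Z) `Z(Ψ γ) = Z(γ)` pointwise AND as subgroups, (R) `IsRegularElt`-preserving, (C) `Ψ U₀ ⊆ U₀`, (T) `Ψ^k γ → 1`, (S)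
`1_{U₀}·(F∘Ψ) ∈ C_c^∞`, `1 < ‖q‖`, `a ≥ 1` off `[1]`, (SC).  Proof = ★ FILE 1∕2 on the model `U(σ_w, Φ₂)(L_w)`, transported along the topological group isomorphism `e`
(regularity through ★ `isRegularElt_iff_separable_localNonsplitEquiv_two`; `C_c^∞` through ★ `isLocSmooth_comp_homeomorph`).

HONEST LABEL.  HC_CM is proved only modulo the 7 printed citations (2 remaining named inputs: hLiu418 = `stmt-HodgeConjecture-24832`, h413 = `stmt-HodgeConjecture-24833`)
until rung 0 closes; this file is a count-neutral helper of the U3b-c sub-line; ‹SC₂-explicit› is a HYPOTHESIS here (the rank-one scaling law is a separate file).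
REFERENCES: [Rogawski1990] Rogawski, *Automorphic representations of unitary groups in three variables* (1990), §8.1 Prop. 8.1.2 (b) p. 114, (8.1.1) p. 116 ·
[HarishChandra1999AdmissibleDistributions] Harish-Chandra, ULS 16 (1999), §3.1 Lemma 3.2 · [PlatonovRapinchuk1994] Platonov–Rapinchuk (1994), §3.3, §5.1.
-/

set_option autoImplicit false
set_option linter.dupNamespace false  -- the mandated namespace repeats the single-problem summit's segment, as in every `Theorems/*.lean` here

noncomputable section

open NumberField IsDedekindDomain MeasureTheory Filter Topology Set
open scoped Matrix MatrixGroups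
open Literature.NumberTheory.Rogawski1990 Literature.NumberTheory.Automorphic Literature.NumberTheory.Automorphic.UnitaryGroup
open Literature.NumberTheory.Weil1982.UnitaryFinTopForm
open Summit.HodgeConjecture.HodgeConjecture.Cruxes.H413.K2E3CayleyScalingRankOne Summit.HodgeConjecture.HodgeConjecture.Cruxes.H413.K2E3CayleyScalingRankOneMap
open Summit.HodgeConjecture.HodgeConjecture.Cruxes.H413.K2E3CayleyScalingPackage (isLocSmooth_comp_homeomorph)
open Summit.HodgeConjecture.HodgeConjecture.Cruxes.H413.F0P3cStCharTSCartanFinTwo (isRegularElt_iff_separable_localNonsplitEquiv_two)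

namespace Summit.HodgeConjecture.HodgeConjecture.Cruxes.H413.K2E3CayleyScalingRankOnePackage

set_option maxHeartbeats 1600000 in
/-- **THE RANK-ONE CAYLEY SCALING PACKAGE on the carrier `↥(UnitaryGroup.«local» L c 2 Φ₂ v)`** (which IS `(cmDatum L 2 Φ₂).Local v`, ★ `cmDatum_Local` `rfl`; the
`cmDatum`-typed head below is its definitional transport): **‹SC₂-explicit› ⟹ ‹Ψ-package›₂**.  If at every non-split `v` there are `w ∣ v`, `s ∈ L_w`
(`σ_w s = s`, `0 < ‖s‖ < 1`), `0 < ρ < 1`, `1 < ‖q‖` and exponents `a` (`a u ≥ 1` off `[1]`) such that the SCALING LAW holds for EVERY pair `(Ψ, U₀)` = (the eigenvalue ball of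
radius `ρ`, a map agreeing with `c ∘ (s·) ∘ c⁻¹` on it, read at `w` through the one-place model), THEN such a pair EXISTS (★ FILE 1 `exists_cayleyScaling`) with: `U₀ ∈ 𝓝 1`,
`U₀` Ad-stable, `Ψ` equivariant, `Z(Ψ γ) = Z(γ)` (pointwise and as subgroups), `Ψ` regularity-preserving, `Ψ U₀ ⊆ U₀`, `Ψ^k γ → 1`, `1_{U₀}·(F∘Ψ) ∈ C_c^∞`, and (SC) — ★ FILE 1∕2
transported along `e = localNonsplitEquiv`.  Print: Harish-Chandra's dilation read on the group through the Cayley chart ([HarishChandra1999] §3.1 Lemma 3.2), the mechanism of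
[Rogawski1990] Prop. 8.1.2 (b) («`Γ_u(exp(t²Y)γ) = |t|^{−d(u)}Γ_u(exp(Y)γ)`», `d(u_reg) = 2` in rank one). [cite: Rogawski1990, §8.1 Prop. 8.1.2 (b) p. 114; (8.1.1) p. 116]
[cite: HarishChandra1999AdmissibleDistributions, §3.1 Lemma 3.2] [cite: PlatonovRapinchuk1994, §3.3; §5.1] -/
theorem psiPackage_of_scalingLaw_local_two
    (hSC : ∀ (L : Type) [Field L] [NumberField L] [IsCMField L] (v : HeightOneSpectrum (𝓞 ↥(maximalRealSubfield L))),
      (∀ w : PlacesOver L v, IsCMField.complexConj L • w.1 = w.1) →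
      ∀ [MeasurableSpace (↥(«local» L (IsCMField.complexConj L) 2 (Matrix.of fun i j : Fin 2 => if i.val + j.val + 1 = 2 then (1 : L) else 0) v))]
        [BorelSpace (↥(«local» L (IsCMField.complexConj L) 2 (Matrix.of fun i j : Fin 2 => if i.val + j.val + 1 = 2 then (1 : L) else 0) v))]
        [∀ γ : ↥(«local» L (IsCMField.complexConj L) 2 (Matrix.of fun i j : Fin 2 => if i.val + j.val + 1 = 2 then (1 : L) else 0) v),
          MeasurableSpace (↥(«local» L (IsCMField.complexConj L) 2 (Matrix.of fun i j : Fin 2 => if i.val + j.val + 1 = 2 then (1 : L) else 0) v) ⧸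
            Subgroup.centralizer ({γ} : Set (↥(«local» L (IsCMField.complexConj L) 2 (Matrix.of fun i j : Fin 2 => if i.val + j.val + 1 = 2 then (1 : L) else 0) v))))]
        [∀ γ : ↥(«local» L (IsCMField.complexConj L) 2 (Matrix.of fun i j : Fin 2 => if i.val + j.val + 1 = 2 then (1 : L) else 0) v),
          BorelSpace (↥(«local» L (IsCMField.complexConj L) 2 (Matrix.of fun i j : Fin 2 => if i.val + j.val + 1 = 2 then (1 : L) else 0) v) ⧸
            Subgroup.centralizer ({γ} : Set (↥(«local» L (IsCMField.complexConj L) 2 (Matrix.of fun i j : Fin 2 => if i.val + j.val + 1 = 2 then (1 : L) else 0) v))))],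
      ∃ (w : PlacesOver L v) (hw : IsCMField.complexConj L • w.1 = w.1) (s : w.1.adicCompletion L) (ρ : ℝ) (q : ℂ)
        (a : ConjClasses (↥(«local» L (IsCMField.complexConj L) 2 (Matrix.of fun i j : Fin 2 => if i.val + j.val + 1 = 2 then (1 : L) else 0) v)) → ℕ),
        galAdicCompletionMap (L := L) (IsCMField.complexConj L) hw s = s ∧ s ≠ 0 ∧ ‖s‖ < 1 ∧ 0 < ρ ∧ ρ < 1 ∧ 1 < ‖q‖ ∧
        (∀ u : ConjClasses (↥(«local» L (IsCMField.complexConj L) 2 (Matrix.of fun i j : Fin 2 => if i.val + j.val + 1 = 2 then (1 : L) else 0) v)), u ≠ ConjClasses.mk 1 → 1 ≤ a u) ∧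
        ∀ (Ψ : ↥(«local» L (IsCMField.complexConj L) 2 (Matrix.of fun i j : Fin 2 => if i.val + j.val + 1 = 2 then (1 : L) else 0) v) →
            ↥(«local» L (IsCMField.complexConj L) 2 (Matrix.of fun i j : Fin 2 => if i.val + j.val + 1 = 2 then (1 : L) else 0) v))
          (U₀ : Set (↥(«local» L (IsCMField.complexConj L) 2 (Matrix.of fun i j : Fin 2 => if i.val + j.val + 1 = 2 then (1 : L) else 0) v))),
          (∀ γ : ↥(«local» L (IsCMField.complexConj L) 2 (Matrix.of fun i j : Fin 2 => if i.val + j.val + 1 = 2 then (1 : L) else 0) v), γ ∈ U₀ ↔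
            IsUnit ((((localNonsplitEquiv (IsCMField.complexConj L) (Matrix.of fun i j : Fin 2 => if i.val + j.val + 1 = 2 then (1 : L) else 0) (IsCMField.complexConj_ne_one L) w hw γ :
                ↥(unitaryGroupOfForm (galAdicCompletionMap (L := L) (IsCMField.complexConj L) hw) (placeForm (Matrix.of fun i j : Fin 2 => if i.val + j.val + 1 = 2 then (1 : L) else 0) w.1))) :
                  GL (Fin 2) (w.1.adicCompletion L)) : Matrix (Fin 2) (Fin 2) (w.1.adicCompletion L)) + 1).det ∧
            ‖(((((localNonsplitEquiv (IsCMField.complexConj L) (Matrix.of fun i j : Fin 2 => if i.val + j.val + 1 = 2 then (1 : L) else 0) (IsCMField.complexConj_ne_one L) w hw γ :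
                ↥(unitaryGroupOfForm (galAdicCompletionMap (L := L) (IsCMField.complexConj L) hw) (placeForm (Matrix.of fun i j : Fin 2 => if i.val + j.val + 1 = 2 then (1 : L) else 0) w.1))) :
                  GL (Fin 2) (w.1.adicCompletion L)) : Matrix (Fin 2) (Fin 2) (w.1.adicCompletion L)) - 1) *
                ((((localNonsplitEquiv (IsCMField.complexConj L) (Matrix.of fun i j : Fin 2 => if i.val + j.val + 1 = 2 then (1 : L) else 0) (IsCMField.complexConj_ne_one L) w hw γ :
                ↥(unitaryGroupOfForm (galAdicCompletionMap (L := L) (IsCMField.complexConj L) hw) (placeForm (Matrix.of fun i j : Fin 2 => if i.val + j.val + 1 = 2 then (1 : L) else 0) w.1))) :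
                  GL (Fin 2) (w.1.adicCompletion L)) : Matrix (Fin 2) (Fin 2) (w.1.adicCompletion L)) + 1)⁻¹).trace‖ ≤ ρ ∧
            ‖(((((localNonsplitEquiv (IsCMField.complexConj L) (Matrix.of fun i j : Fin 2 => if i.val + j.val + 1 = 2 then (1 : L) else 0) (IsCMField.complexConj_ne_one L) w hw γ :
                ↥(unitaryGroupOfForm (galAdicCompletionMap (L := L) (IsCMField.complexConj L) hw) (placeForm (Matrix.of fun i j : Fin 2 => if i.val + j.val + 1 = 2 then (1 : L) else 0) w.1))) :
                  GL (Fin 2) (w.1.adicCompletion L)) : Matrix (Fin 2) (Fin 2) (w.1.adicCompletion L)) - 1) *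
                ((((localNonsplitEquiv (IsCMField.complexConj L) (Matrix.of fun i j : Fin 2 => if i.val + j.val + 1 = 2 then (1 : L) else 0) (IsCMField.complexConj_ne_one L) w hw γ :
                ↥(unitaryGroupOfForm (galAdicCompletionMap (L := L) (IsCMField.complexConj L) hw) (placeForm (Matrix.of fun i j : Fin 2 => if i.val + j.val + 1 = 2 then (1 : L) else 0) w.1))) :
                  GL (Fin 2) (w.1.adicCompletion L)) : Matrix (Fin 2) (Fin 2) (w.1.adicCompletion L)) + 1)⁻¹).det‖ ≤ ρ ^ 2) →
          (∀ γ ∈ U₀,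
            (((localNonsplitEquiv (IsCMField.complexConj L) (Matrix.of fun i j : Fin 2 => if i.val + j.val + 1 = 2 then (1 : L) else 0) (IsCMField.complexConj_ne_one L) w hw (Ψ γ) :
                ↥(unitaryGroupOfForm (galAdicCompletionMap (L := L) (IsCMField.complexConj L) hw) (placeForm (Matrix.of fun i j : Fin 2 => if i.val + j.val + 1 = 2 then (1 : L) else 0) w.1))) :
                  GL (Fin 2) (w.1.adicCompletion L)) : Matrix (Fin 2) (Fin 2) (w.1.adicCompletion L)) =
              cayley (s • (((((localNonsplitEquiv (IsCMField.complexConj L) (Matrix.of fun i j : Fin 2 => if i.val + j.val + 1 = 2 then (1 : L) else 0) (IsCMField.complexConj_ne_one L) w hw γ :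
                ↥(unitaryGroupOfForm (galAdicCompletionMap (L := L) (IsCMField.complexConj L) hw) (placeForm (Matrix.of fun i j : Fin 2 => if i.val + j.val + 1 = 2 then (1 : L) else 0) w.1))) :
                  GL (Fin 2) (w.1.adicCompletion L)) : Matrix (Fin 2) (Fin 2) (w.1.adicCompletion L)) - 1) *
                ((((localNonsplitEquiv (IsCMField.complexConj L) (Matrix.of fun i j : Fin 2 => if i.val + j.val + 1 = 2 then (1 : L) else 0) (IsCMField.complexConj_ne_one L) w hw γ :
                ↥(unitaryGroupOfForm (galAdicCompletionMap (L := L) (IsCMField.complexConj L) hw) (placeForm (Matrix.of fun i j : Fin 2 => if i.val + j.val + 1 = 2 then (1 : L) else 0) w.1))) :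
                  GL (Fin 2) (w.1.adicCompletion L)) : Matrix (Fin 2) (Fin 2) (w.1.adicCompletion L)) + 1)⁻¹))) →
          ∀ (S : Finset (ConjClasses (↥(«local» L (IsCMField.complexConj L) 2 (Matrix.of fun i j : Fin 2 => if i.val + j.val + 1 = 2 then (1 : L) else 0) v))))
            (mU : OrbitalMeasureFamily (↥(«local» L (IsCMField.complexConj L) 2 (Matrix.of fun i j : Fin 2 => if i.val + j.val + 1 = 2 then (1 : L) else 0) v))),
            (∀ u ∈ S, (((Quotient.out u : ↥(«local» L (IsCMField.complexConj L) 2 (Matrix.of fun i j : Fin 2 => if i.val + j.val + 1 = 2 then (1 : L) else 0) v)).val :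
                GL (Fin 2) (UnitaryGroup.LocalRing L v)).val - 1) ^ 2 = 0) →
            mU.IsAdmissibleOn (fun γ : ↥(«local» L (IsCMField.complexConj L) 2 (Matrix.of fun i j : Fin 2 => if i.val + j.val + 1 = 2 then (1 : L) else 0) v) => (ConjClasses.mk γ) ∈ S) →
            ∀ u ∈ S, ∀ F : ↥(«local» L (IsCMField.complexConj L) 2 (Matrix.of fun i j : Fin 2 => if i.val + j.val + 1 = 2 then (1 : L) else 0) v) → ℂ, IsLocSmooth F →
              classOrbitalIntegral mU (U₀.indicator (F ∘ Ψ)) u = q ^ (a u) * classOrbitalIntegral mU F u) :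
    ∀ (L : Type) [Field L] [NumberField L] [IsCMField L] (v : HeightOneSpectrum (𝓞 ↥(maximalRealSubfield L))),
      (∀ w : PlacesOver L v, IsCMField.complexConj L • w.1 = w.1) →
      ∀ [MeasurableSpace (↥(«local» L (IsCMField.complexConj L) 2 (Matrix.of fun i j : Fin 2 => if i.val + j.val + 1 = 2 then (1 : L) else 0) v))]
        [BorelSpace (↥(«local» L (IsCMField.complexConj L) 2 (Matrix.of fun i j : Fin 2 => if i.val + j.val + 1 = 2 then (1 : L) else 0) v))]
        [∀ γ : ↥(«local» L (IsCMField.complexConj L) 2 (Matrix.of fun i j : Fin 2 => if i.val + j.val + 1 = 2 then (1 : L) else 0) v),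
          MeasurableSpace (↥(«local» L (IsCMField.complexConj L) 2 (Matrix.of fun i j : Fin 2 => if i.val + j.val + 1 = 2 then (1 : L) else 0) v) ⧸
            Subgroup.centralizer ({γ} : Set (↥(«local» L (IsCMField.complexConj L) 2 (Matrix.of fun i j : Fin 2 => if i.val + j.val + 1 = 2 then (1 : L) else 0) v))))]
        [∀ γ : ↥(«local» L (IsCMField.complexConj L) 2 (Matrix.of fun i j : Fin 2 => if i.val + j.val + 1 = 2 then (1 : L) else 0) v),
          BorelSpace (↥(«local» L (IsCMField.complexConj L) 2 (Matrix.of fun i j : Fin 2 => if i.val + j.val + 1 = 2 then (1 : L) else 0) v) ⧸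
            Subgroup.centralizer ({γ} : Set (↥(«local» L (IsCMField.complexConj L) 2 (Matrix.of fun i j : Fin 2 => if i.val + j.val + 1 = 2 then (1 : L) else 0) v))))],
      ∃ (Ψ : ↥(«local» L (IsCMField.complexConj L) 2 (Matrix.of fun i j : Fin 2 => if i.val + j.val + 1 = 2 then (1 : L) else 0) v) →
            ↥(«local» L (IsCMField.complexConj L) 2 (Matrix.of fun i j : Fin 2 => if i.val + j.val + 1 = 2 then (1 : L) else 0) v))
        (U₀ : Set (↥(«local» L (IsCMField.complexConj L) 2 (Matrix.of fun i j : Fin 2 => if i.val + j.val + 1 = 2 then (1 : L) else 0) v))) (q : ℂ)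
        (a : ConjClasses (↥(«local» L (IsCMField.complexConj L) 2 (Matrix.of fun i j : Fin 2 => if i.val + j.val + 1 = 2 then (1 : L) else 0) v)) → ℕ),
        U₀ ∈ 𝓝 (1 : ↥(«local» L (IsCMField.complexConj L) 2 (Matrix.of fun i j : Fin 2 => if i.val + j.val + 1 = 2 then (1 : L) else 0) v)) ∧
        (∀ γ ∈ U₀, ∀ x : ↥(«local» L (IsCMField.complexConj L) 2 (Matrix.of fun i j : Fin 2 => if i.val + j.val + 1 = 2 then (1 : L) else 0) v), x * γ * x⁻¹ ∈ U₀) ∧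
        (∀ γ ∈ U₀, ∀ x : ↥(«local» L (IsCMField.complexConj L) 2 (Matrix.of fun i j : Fin 2 => if i.val + j.val + 1 = 2 then (1 : L) else 0) v), Ψ (x * γ * x⁻¹) = x * Ψ γ * x⁻¹) ∧
        (∀ γ ∈ U₀, (∀ z : ↥(«local» L (IsCMField.complexConj L) 2 (Matrix.of fun i j : Fin 2 => if i.val + j.val + 1 = 2 then (1 : L) else 0) v), z * γ = γ * z ↔ z * Ψ γ = Ψ γ * z) ∧
          Subgroup.centralizer ({Ψ γ} : Set (↥(«local» L (IsCMField.complexConj L) 2 (Matrix.of fun i j : Fin 2 => if i.val + j.val + 1 = 2 then (1 : L) else 0) v))) =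
            Subgroup.centralizer ({γ} : Set (↥(«local» L (IsCMField.complexConj L) 2 (Matrix.of fun i j : Fin 2 => if i.val + j.val + 1 = 2 then (1 : L) else 0) v)))) ∧
        (∀ γ ∈ U₀, IsRegularElt (γ : GL (Fin 2) (UnitaryGroup.LocalRing L v)) →
          IsRegularElt ((Ψ γ : ↥(«local» L (IsCMField.complexConj L) 2 (Matrix.of fun i j : Fin 2 => if i.val + j.val + 1 = 2 then (1 : L) else 0) v)) : GL (Fin 2) (UnitaryGroup.LocalRing L v))) ∧
        (∀ γ ∈ U₀, Ψ γ ∈ U₀) ∧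
        (∀ γ ∈ U₀, Tendsto (fun k : ℕ => Ψ^[k] γ) atTop (𝓝 (1 : ↥(«local» L (IsCMField.complexConj L) 2 (Matrix.of fun i j : Fin 2 => if i.val + j.val + 1 = 2 then (1 : L) else 0) v)))) ∧
        (∀ F : ↥(«local» L (IsCMField.complexConj L) 2 (Matrix.of fun i j : Fin 2 => if i.val + j.val + 1 = 2 then (1 : L) else 0) v) → ℂ, IsLocSmooth F → IsLocSmooth (U₀.indicator (F ∘ Ψ))) ∧
        1 < ‖q‖ ∧
        (∀ u : ConjClasses (↥(«local» L (IsCMField.complexConj L) 2 (Matrix.of fun i j : Fin 2 => if i.val + j.val + 1 = 2 then (1 : L) else 0) v)), u ≠ ConjClasses.mk 1 → 1 ≤ a u) ∧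
        ∀ (S : Finset (ConjClasses (↥(«local» L (IsCMField.complexConj L) 2 (Matrix.of fun i j : Fin 2 => if i.val + j.val + 1 = 2 then (1 : L) else 0) v))))
          (mU : OrbitalMeasureFamily (↥(«local» L (IsCMField.complexConj L) 2 (Matrix.of fun i j : Fin 2 => if i.val + j.val + 1 = 2 then (1 : L) else 0) v))),
          (∀ u ∈ S, (((Quotient.out u : ↥(«local» L (IsCMField.complexConj L) 2 (Matrix.of fun i j : Fin 2 => if i.val + j.val + 1 = 2 then (1 : L) else 0) v)).val :
              GL (Fin 2) (UnitaryGroup.LocalRing L v)).val - 1) ^ 2 = 0) →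
          mU.IsAdmissibleOn (fun γ : ↥(«local» L (IsCMField.complexConj L) 2 (Matrix.of fun i j : Fin 2 => if i.val + j.val + 1 = 2 then (1 : L) else 0) v) => (ConjClasses.mk γ) ∈ S) →
          ∀ u ∈ S, ∀ F : ↥(«local» L (IsCMField.complexConj L) 2 (Matrix.of fun i j : Fin 2 => if i.val + j.val + 1 = 2 then (1 : L) else 0) v) → ℂ, IsLocSmooth F →
            classOrbitalIntegral mU (U₀.indicator (F ∘ Ψ)) u = q ^ (a u) * classOrbitalIntegral mU F u := by
  intro L _ _ _ v hns _ _ _ _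
  obtain ⟨w, hw, s, ρ, q, a, hσs, hs0, hs1, hρ0, hρ1, hq, ha, hlaw⟩ := hSC L v hns
  -- the one-place data
  set σ := galAdicCompletionMap (L := L) (IsCMField.complexConj L) hw with hσ_def
  set J := placeForm (Matrix.of fun i j : Fin 2 => if i.val + j.val + 1 = 2 then (1 : L) else 0) w.1 with hJ_def
  set e := localNonsplitEquiv (IsCMField.complexConj L) (Matrix.of fun i j : Fin 2 => if i.val + j.val + 1 = 2 then (1 : L) else 0) (IsCMField.complexConj_ne_one L) w hw
    with he_def
  have h2 : (2 : w.1.adicCompletion L) ≠ 0 := two_ne_zero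
  have hsρ : ‖s‖ * ρ < 1 := lt_of_le_of_lt (mul_le_of_le_one_left hρ0.le hs1.le) hρ1
  have hsρ0 : 0 < ‖s‖ * ρ := mul_pos (norm_pos_iff.2 hs0) hρ0
  have hsρ' : ‖s⁻¹‖ * (‖s‖ * ρ) < 1 := by rwa [norm_inv, ← mul_assoc, inv_mul_cancel₀ (norm_ne_zero_iff.2 hs0), one_mul]
  have hσs' : σ s⁻¹ = s⁻¹ := by rw [map_inv₀, hσs]
  -- the eigenvalue balls of radii `ρ` and `‖s‖ρ` in the model, and the two scalings `Ψ₀` (by `s`) and `Θ` (by `s⁻¹`)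
  set B : Set ↥(unitaryGroupOfForm σ J) := {u |
    IsUnit (((u : GL (Fin 2) (w.1.adicCompletion L)) : Matrix (Fin 2) (Fin 2) (w.1.adicCompletion L)) + 1).det ∧
    ‖((((u : GL (Fin 2) (w.1.adicCompletion L)) : Matrix (Fin 2) (Fin 2) (w.1.adicCompletion L)) - 1) *
        (((u : GL (Fin 2) (w.1.adicCompletion L)) : Matrix (Fin 2) (Fin 2) (w.1.adicCompletion L)) + 1)⁻¹).trace‖ ≤ ρ ∧
    ‖((((u : GL (Fin 2) (w.1.adicCompletion L)) : Matrix (Fin 2) (Fin 2) (w.1.adicCompletion L)) - 1) *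
        (((u : GL (Fin 2) (w.1.adicCompletion L)) : Matrix (Fin 2) (Fin 2) (w.1.adicCompletion L)) + 1)⁻¹).det‖ ≤ ρ ^ 2} with hB_def
  have hB : ∀ u : ↥(unitaryGroupOfForm σ J), u ∈ B ↔
      IsUnit (((u : GL (Fin 2) (w.1.adicCompletion L)) : Matrix (Fin 2) (Fin 2) (w.1.adicCompletion L)) + 1).det ∧
      ‖((((u : GL (Fin 2) (w.1.adicCompletion L)) : Matrix (Fin 2) (Fin 2) (w.1.adicCompletion L)) - 1) *
          (((u : GL (Fin 2) (w.1.adicCompletion L)) : Matrix (Fin 2) (Fin 2) (w.1.adicCompletion L)) + 1)⁻¹).trace‖ ≤ ρ ∧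
      ‖((((u : GL (Fin 2) (w.1.adicCompletion L)) : Matrix (Fin 2) (Fin 2) (w.1.adicCompletion L)) - 1) *
          (((u : GL (Fin 2) (w.1.adicCompletion L)) : Matrix (Fin 2) (Fin 2) (w.1.adicCompletion L)) + 1)⁻¹).det‖ ≤ ρ ^ 2 :=
    fun u => Iff.rfl
  set B' : Set ↥(unitaryGroupOfForm σ J) := {u |
    IsUnit (((u : GL (Fin 2) (w.1.adicCompletion L)) : Matrix (Fin 2) (Fin 2) (w.1.adicCompletion L)) + 1).det ∧
    ‖((((u : GL (Fin 2) (w.1.adicCompletion L)) : Matrix (Fin 2) (Fin 2) (w.1.adicCompletion L)) - 1) *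
        (((u : GL (Fin 2) (w.1.adicCompletion L)) : Matrix (Fin 2) (Fin 2) (w.1.adicCompletion L)) + 1)⁻¹).trace‖ ≤ ‖s‖ * ρ ∧
    ‖((((u : GL (Fin 2) (w.1.adicCompletion L)) : Matrix (Fin 2) (Fin 2) (w.1.adicCompletion L)) - 1) *
        (((u : GL (Fin 2) (w.1.adicCompletion L)) : Matrix (Fin 2) (Fin 2) (w.1.adicCompletion L)) + 1)⁻¹).det‖ ≤ (‖s‖ * ρ) ^ 2} with hB'_def
  have hB' : ∀ u : ↥(unitaryGroupOfForm σ J), u ∈ B' ↔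
      IsUnit (((u : GL (Fin 2) (w.1.adicCompletion L)) : Matrix (Fin 2) (Fin 2) (w.1.adicCompletion L)) + 1).det ∧
      ‖((((u : GL (Fin 2) (w.1.adicCompletion L)) : Matrix (Fin 2) (Fin 2) (w.1.adicCompletion L)) - 1) *
          (((u : GL (Fin 2) (w.1.adicCompletion L)) : Matrix (Fin 2) (Fin 2) (w.1.adicCompletion L)) + 1)⁻¹).trace‖ ≤ ‖s‖ * ρ ∧
      ‖((((u : GL (Fin 2) (w.1.adicCompletion L)) : Matrix (Fin 2) (Fin 2) (w.1.adicCompletion L)) - 1) *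
          (((u : GL (Fin 2) (w.1.adicCompletion L)) : Matrix (Fin 2) (Fin 2) (w.1.adicCompletion L)) + 1)⁻¹).det‖ ≤ (‖s‖ * ρ) ^ 2 :=
    fun u => Iff.rfl
  obtain ⟨Ψ₀, hΨ₀⟩ := exists_cayleyScaling σ J hB hσs hsρ
  obtain ⟨Θ, hΘ⟩ := exists_cayleyScaling σ J hB' hσs' hsρ'
  -- the objects on `U(Φ₂)(L⁺_v)`
  refine ⟨fun γ => e.symm (Ψ₀ (e γ)), {γ | e γ ∈ B}, q, a, ?_, ?_, ?_, ?_, ?_, ?_, ?_, ?_, hq, ha, ?_⟩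
  · -- (U1)
    have h1 : B ∈ 𝓝 (e 1) := by rw [map_one]; exact (one_mem_ball_nhds σ J hB hρ0 hρ1 h2).2
    exact e.continuous.continuousAt h1
  · -- (U2)
    intro γ hγ x
    show e (x * γ * x⁻¹) ∈ B
    rw [map_mul, map_mul, map_inv]
    exact (conj_mem_ball_iff σ J hB (e γ) (e x)).2 hγ
  · -- (E)
    intro γ hγ x
    apply e.injective
    rw [ContinuousMulEquiv.apply_symm_apply, map_mul, map_mul, map_inv, map_mul, map_mul, map_inv, ContinuousMulEquiv.apply_symm_apply]
    exact (cayleyScaling_conj_mem σ J hB hΨ₀ hsρ hγ (e x)).2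
  · -- (Z), pointwise and as subgroups
    intro γ hγ
    have hpt : ∀ z : ↥(«local» L (IsCMField.complexConj L) 2 (Matrix.of fun i j : Fin 2 => if i.val + j.val + 1 = 2 then (1 : L) else 0) v),
        z * γ = γ * z ↔ z * e.symm (Ψ₀ (e γ)) = e.symm (Ψ₀ (e γ)) * z := by
      intro z
      have h := (centralizer_cayleyScaling_eq σ J hB hΨ₀ h2 hs0 hsρ hγ).1 (e z)
      constructor
      · intro hzγ
        apply e.injective
        rw [map_mul, map_mul, ContinuousMulEquiv.apply_symm_apply]
        exact h.1 (by rw [← map_mul, ← map_mul, hzγ])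
      · intro hzΨ
        apply e.injective
        rw [map_mul, map_mul]
        refine h.2 ?_
        have := congrArg e hzΨ
        rwa [map_mul, map_mul, ContinuousMulEquiv.apply_symm_apply] at this
    refine ⟨hpt, Subgroup.ext fun z => ?_⟩
    rw [Subgroup.mem_centralizer_singleton_iff, Subgroup.mem_centralizer_singleton_iff]
    exact (hpt z).symm
  · -- (R): regularity on both sides of the one-place model (★ `isRegularElt_iff_separable_localNonsplitEquiv_two`, typed on the `cmDatum` carrier = this carrier by `rfl`)
    intro γ hγ hreg
    have h1 := (isRegularElt_iff_separable_localNonsplitEquiv_two L v w hw γ).1 hreg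
    refine (isRegularElt_iff_separable_localNonsplitEquiv_two L v w hw (e.symm (Ψ₀ (e γ)))).2 ?_
    have hrw : localNonsplitEquiv (IsCMField.complexConj L) (Matrix.of fun i j : Fin 2 => if i.val + j.val + 1 = 2 then (1 : L) else 0) (IsCMField.complexConj_ne_one L) w hw
        (e.symm (Ψ₀ (e γ))) = Ψ₀ (e γ) := by rw [← he_def, ContinuousMulEquiv.apply_symm_apply]
    rw [hrw]
    exact (separable_charpoly_cayleyScaling_iff σ J hB hΨ₀ h2 hs0 hsρ hγ).2 h1
  · -- (C)
    intro γ hγ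
    show e (e.symm (Ψ₀ (e γ))) ∈ B
    rw [ContinuousMulEquiv.apply_symm_apply]
    exact cayleyScaling_mem_of_ball σ J hB hΨ₀ h2 hsρ (mul_le_of_le_one_left hρ0.le hs1.le) hB hγ
  · -- (T)
    intro γ hγ
    have hiter : ∀ k : ℕ, (fun γ' => e.symm (Ψ₀ (e γ')))^[k] γ = e.symm (Ψ₀^[k] (e γ)) := by
      intro k
      induction k with
      | zero => simp
      | succ k ih => rw [Function.iterate_succ_apply', Function.iterate_succ_apply', ih, ContinuousMulEquiv.apply_symm_apply]
    have hc : Continuous (fun x => e.symm x) := e.symm.continuous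
    have ht : Tendsto (fun x => e.symm x) (𝓝 1)
        (𝓝 (1 : ↥(«local» L (IsCMField.complexConj L) 2 (Matrix.of fun i j : Fin 2 => if i.val + j.val + 1 = 2 then (1 : L) else 0) v))) := by
      simpa only [map_one] using hc.tendsto 1
    simp_rw [hiter]
    exact ht.comp (iterate_mem_tendsto_cayleyScaling σ J hB hΨ₀ h2 hs1 hρ1 hγ).2
  · -- (S)
    intro F hF
    have hF' : IsLocSmooth (F ∘ (fun x => e.symm x)) := isLocSmooth_comp_homeomorph e.symm.toHomeomorph hF
    have hS := isLocSmooth_indicator_comp_cayleyScaling σ J hB hΨ₀ h2 hs0 hs1.le hρ0 hρ1 hB' hΘ hF'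
    have heq : {γ : ↥(«local» L (IsCMField.complexConj L) 2 (Matrix.of fun i j : Fin 2 => if i.val + j.val + 1 = 2 then (1 : L) else 0) v) | e γ ∈ B}.indicator
          (F ∘ fun γ => e.symm (Ψ₀ (e γ))) = (B.indicator ((F ∘ fun x => e.symm x) ∘ Ψ₀)) ∘ (fun γ => e γ) := by
      funext γ
      by_cases hγ : e γ ∈ B
      · rw [Function.comp_apply, indicator_of_mem hγ,
          indicator_of_mem (show γ ∈ {γ : ↥(«local» L (IsCMField.complexConj L) 2 (Matrix.of fun i j : Fin 2 => if i.val + j.val + 1 = 2 then (1 : L) else 0) v) | e γ ∈ B} from hγ)]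
        rfl
      · rw [Function.comp_apply, indicator_of_notMem hγ,
          indicator_of_notMem (show γ ∉ {γ : ↥(«local» L (IsCMField.complexConj L) 2 (Matrix.of fun i j : Fin 2 => if i.val + j.val + 1 = 2 then (1 : L) else 0) v) | e γ ∈ B} from hγ)]
    rw [heq]
    exact isLocSmooth_comp_homeomorph e.toHomeomorph hS
  · -- (SC)
    intro S mU hunip hadm u hu F hF
    refine hlaw (fun γ => e.symm (Ψ₀ (e γ))) {γ | e γ ∈ B} (fun γ => Iff.rfl) (fun γ hγ => ?_) S mU hunip hadm u hu F hF
    rw [ContinuousMulEquiv.apply_symm_apply]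
    exact (hΨ₀ (e γ) hγ).1

set_option maxHeartbeats 1600000 in
/-- **THE RANK-ONE CAYLEY SCALING PACKAGE: ‹SC₂-explicit› ⟹ ‹Ψ-package›₂** on `U(Φ₂)(L⁺_v) = (cmDatum L 2 Φ₂).Local v` — the spelling of U3b's sockets ((HOM-ray*)
`sig_K2E3CentralGermHomogeneityRayRef`); the definitional transport of `psiPackage_of_scalingLaw_local_two` (★ `cmDatum_Local` is `rfl`).  See the module docstring.
[cite: Rogawski1990, §8.1 Prop. 8.1.2 (b) p. 114; (8.1.1) p. 116] [cite: HarishChandra1999AdmissibleDistributions, §3.1 Lemma 3.2] [cite: PlatonovRapinchuk1994, §3.3; §5.1] -/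
theorem psiPackage_of_scalingLaw_two
    (hSC : ∀ (L : Type) [Field L] [NumberField L] [IsCMField L] (v : HeightOneSpectrum (𝓞 ↥(maximalRealSubfield L))),
      (∀ w : PlacesOver L v, IsCMField.complexConj L • w.1 = w.1) →
      ∀ [MeasurableSpace ((UnitaryGroup.cmDatum L 2 (Matrix.of fun i j : Fin 2 => if i.val + j.val + 1 = 2 then (1 : L) else 0)).Local v)]
        [BorelSpace ((UnitaryGroup.cmDatum L 2 (Matrix.of fun i j : Fin 2 => if i.val + j.val + 1 = 2 then (1 : L) else 0)).Local v)]
        [∀ γ : (UnitaryGroup.cmDatum L 2 (Matrix.of fun i j : Fin 2 => if i.val + j.val + 1 = 2 then (1 : L) else 0)).Local v,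
          MeasurableSpace ((UnitaryGroup.cmDatum L 2 (Matrix.of fun i j : Fin 2 => if i.val + j.val + 1 = 2 then (1 : L) else 0)).Local v ⧸
            Subgroup.centralizer ({γ} : Set ((UnitaryGroup.cmDatum L 2 (Matrix.of fun i j : Fin 2 => if i.val + j.val + 1 = 2 then (1 : L) else 0)).Local v)))]
        [∀ γ : (UnitaryGroup.cmDatum L 2 (Matrix.of fun i j : Fin 2 => if i.val + j.val + 1 = 2 then (1 : L) else 0)).Local v,
          BorelSpace ((UnitaryGroup.cmDatum L 2 (Matrix.of fun i j : Fin 2 => if i.val + j.val + 1 = 2 then (1 : L) else 0)).Local v ⧸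
            Subgroup.centralizer ({γ} : Set ((UnitaryGroup.cmDatum L 2 (Matrix.of fun i j : Fin 2 => if i.val + j.val + 1 = 2 then (1 : L) else 0)).Local v)))],
      ∃ (w : PlacesOver L v) (hw : IsCMField.complexConj L • w.1 = w.1) (s : w.1.adicCompletion L) (ρ : ℝ) (q : ℂ)
        (a : ConjClasses ((UnitaryGroup.cmDatum L 2 (Matrix.of fun i j : Fin 2 => if i.val + j.val + 1 = 2 then (1 : L) else 0)).Local v) → ℕ),
        galAdicCompletionMap (L := L) (IsCMField.complexConj L) hw s = s ∧ s ≠ 0 ∧ ‖s‖ < 1 ∧ 0 < ρ ∧ ρ < 1 ∧ 1 < ‖q‖ ∧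
        (∀ u : ConjClasses ((UnitaryGroup.cmDatum L 2 (Matrix.of fun i j : Fin 2 => if i.val + j.val + 1 = 2 then (1 : L) else 0)).Local v), u ≠ ConjClasses.mk 1 → 1 ≤ a u) ∧
        ∀ (Ψ : (UnitaryGroup.cmDatum L 2 (Matrix.of fun i j : Fin 2 => if i.val + j.val + 1 = 2 then (1 : L) else 0)).Local v →
            (UnitaryGroup.cmDatum L 2 (Matrix.of fun i j : Fin 2 => if i.val + j.val + 1 = 2 then (1 : L) else 0)).Local v)
          (U₀ : Set ((UnitaryGroup.cmDatum L 2 (Matrix.of fun i j : Fin 2 => if i.val + j.val + 1 = 2 then (1 : L) else 0)).Local v)),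
          (∀ γ : (UnitaryGroup.cmDatum L 2 (Matrix.of fun i j : Fin 2 => if i.val + j.val + 1 = 2 then (1 : L) else 0)).Local v, γ ∈ U₀ ↔
            IsUnit ((((localNonsplitEquiv (IsCMField.complexConj L) (Matrix.of fun i j : Fin 2 => if i.val + j.val + 1 = 2 then (1 : L) else 0) (IsCMField.complexConj_ne_one L) w hw γ :
                ↥(unitaryGroupOfForm (galAdicCompletionMap (L := L) (IsCMField.complexConj L) hw) (placeForm (Matrix.of fun i j : Fin 2 => if i.val + j.val + 1 = 2 then (1 : L) else 0) w.1))) :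
                  GL (Fin 2) (w.1.adicCompletion L)) : Matrix (Fin 2) (Fin 2) (w.1.adicCompletion L)) + 1).det ∧
            ‖(((((localNonsplitEquiv (IsCMField.complexConj L) (Matrix.of fun i j : Fin 2 => if i.val + j.val + 1 = 2 then (1 : L) else 0) (IsCMField.complexConj_ne_one L) w hw γ :
                ↥(unitaryGroupOfForm (galAdicCompletionMap (L := L) (IsCMField.complexConj L) hw) (placeForm (Matrix.of fun i j : Fin 2 => if i.val + j.val + 1 = 2 then (1 : L) else 0) w.1))) :
                  GL (Fin 2) (w.1.adicCompletion L)) : Matrix (Fin 2) (Fin 2) (w.1.adicCompletion L)) - 1) *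
                ((((localNonsplitEquiv (IsCMField.complexConj L) (Matrix.of fun i j : Fin 2 => if i.val + j.val + 1 = 2 then (1 : L) else 0) (IsCMField.complexConj_ne_one L) w hw γ :
                ↥(unitaryGroupOfForm (galAdicCompletionMap (L := L) (IsCMField.complexConj L) hw) (placeForm (Matrix.of fun i j : Fin 2 => if i.val + j.val + 1 = 2 then (1 : L) else 0) w.1))) :
                  GL (Fin 2) (w.1.adicCompletion L)) : Matrix (Fin 2) (Fin 2) (w.1.adicCompletion L)) + 1)⁻¹).trace‖ ≤ ρ ∧
            ‖(((((localNonsplitEquiv (IsCMField.complexConj L) (Matrix.of fun i j : Fin 2 => if i.val + j.val + 1 = 2 then (1 : L) else 0) (IsCMField.complexConj_ne_one L) w hw γ :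
                ↥(unitaryGroupOfForm (galAdicCompletionMap (L := L) (IsCMField.complexConj L) hw) (placeForm (Matrix.of fun i j : Fin 2 => if i.val + j.val + 1 = 2 then (1 : L) else 0) w.1))) :
                  GL (Fin 2) (w.1.adicCompletion L)) : Matrix (Fin 2) (Fin 2) (w.1.adicCompletion L)) - 1) *
                ((((localNonsplitEquiv (IsCMField.complexConj L) (Matrix.of fun i j : Fin 2 => if i.val + j.val + 1 = 2 then (1 : L) else 0) (IsCMField.complexConj_ne_one L) w hw γ :
                ↥(unitaryGroupOfForm (galAdicCompletionMap (L := L) (IsCMField.complexConj L) hw) (placeForm (Matrix.of fun i j : Fin 2 => if i.val + j.val + 1 = 2 then (1 : L) else 0) w.1))) :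
                  GL (Fin 2) (w.1.adicCompletion L)) : Matrix (Fin 2) (Fin 2) (w.1.adicCompletion L)) + 1)⁻¹).det‖ ≤ ρ ^ 2) →
          (∀ γ ∈ U₀,
            (((localNonsplitEquiv (IsCMField.complexConj L) (Matrix.of fun i j : Fin 2 => if i.val + j.val + 1 = 2 then (1 : L) else 0) (IsCMField.complexConj_ne_one L) w hw (Ψ γ) :
                ↥(unitaryGroupOfForm (galAdicCompletionMap (L := L) (IsCMField.complexConj L) hw) (placeForm (Matrix.of fun i j : Fin 2 => if i.val + j.val + 1 = 2 then (1 : L) else 0) w.1))) :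
                  GL (Fin 2) (w.1.adicCompletion L)) : Matrix (Fin 2) (Fin 2) (w.1.adicCompletion L)) =
              cayley (s • (((((localNonsplitEquiv (IsCMField.complexConj L) (Matrix.of fun i j : Fin 2 => if i.val + j.val + 1 = 2 then (1 : L) else 0) (IsCMField.complexConj_ne_one L) w hw γ :
                ↥(unitaryGroupOfForm (galAdicCompletionMap (L := L) (IsCMField.complexConj L) hw) (placeForm (Matrix.of fun i j : Fin 2 => if i.val + j.val + 1 = 2 then (1 : L) else 0) w.1))) :
                  GL (Fin 2) (w.1.adicCompletion L)) : Matrix (Fin 2) (Fin 2) (w.1.adicCompletion L)) - 1) *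
                ((((localNonsplitEquiv (IsCMField.complexConj L) (Matrix.of fun i j : Fin 2 => if i.val + j.val + 1 = 2 then (1 : L) else 0) (IsCMField.complexConj_ne_one L) w hw γ :
                ↥(unitaryGroupOfForm (galAdicCompletionMap (L := L) (IsCMField.complexConj L) hw) (placeForm (Matrix.of fun i j : Fin 2 => if i.val + j.val + 1 = 2 then (1 : L) else 0) w.1))) :
                  GL (Fin 2) (w.1.adicCompletion L)) : Matrix (Fin 2) (Fin 2) (w.1.adicCompletion L)) + 1)⁻¹))) →
          ∀ (S : Finset (ConjClasses ((UnitaryGroup.cmDatum L 2 (Matrix.of fun i j : Fin 2 => if i.val + j.val + 1 = 2 then (1 : L) else 0)).Local v)))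
            (mU : OrbitalMeasureFamily ((UnitaryGroup.cmDatum L 2 (Matrix.of fun i j : Fin 2 => if i.val + j.val + 1 = 2 then (1 : L) else 0)).Local v)),
            (∀ u ∈ S, (((Quotient.out u : (UnitaryGroup.cmDatum L 2 (Matrix.of fun i j : Fin 2 => if i.val + j.val + 1 = 2 then (1 : L) else 0)).Local v).val :
                GL (Fin 2) (UnitaryGroup.LocalRing L v)).val - 1) ^ 2 = 0) →
            mU.IsAdmissibleOn (fun γ : (UnitaryGroup.cmDatum L 2 (Matrix.of fun i j : Fin 2 => if i.val + j.val + 1 = 2 then (1 : L) else 0)).Local v => (ConjClasses.mk γ) ∈ S) →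
            ∀ u ∈ S, ∀ F : (UnitaryGroup.cmDatum L 2 (Matrix.of fun i j : Fin 2 => if i.val + j.val + 1 = 2 then (1 : L) else 0)).Local v → ℂ, IsLocSmooth F →
              classOrbitalIntegral mU (U₀.indicator (F ∘ Ψ)) u = q ^ (a u) * classOrbitalIntegral mU F u) :
    ∀ (L : Type) [Field L] [NumberField L] [IsCMField L] (v : HeightOneSpectrum (𝓞 ↥(maximalRealSubfield L))),
      (∀ w : PlacesOver L v, IsCMField.complexConj L • w.1 = w.1) →
      ∀ [MeasurableSpace ((UnitaryGroup.cmDatum L 2 (Matrix.of fun i j : Fin 2 => if i.val + j.val + 1 = 2 then (1 : L) else 0)).Local v)]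
        [BorelSpace ((UnitaryGroup.cmDatum L 2 (Matrix.of fun i j : Fin 2 => if i.val + j.val + 1 = 2 then (1 : L) else 0)).Local v)]
        [∀ γ : (UnitaryGroup.cmDatum L 2 (Matrix.of fun i j : Fin 2 => if i.val + j.val + 1 = 2 then (1 : L) else 0)).Local v,
          MeasurableSpace ((UnitaryGroup.cmDatum L 2 (Matrix.of fun i j : Fin 2 => if i.val + j.val + 1 = 2 then (1 : L) else 0)).Local v ⧸
            Subgroup.centralizer ({γ} : Set ((UnitaryGroup.cmDatum L 2 (Matrix.of fun i j : Fin 2 => if i.val + j.val + 1 = 2 then (1 : L) else 0)).Local v)))]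
        [∀ γ : (UnitaryGroup.cmDatum L 2 (Matrix.of fun i j : Fin 2 => if i.val + j.val + 1 = 2 then (1 : L) else 0)).Local v,
          BorelSpace ((UnitaryGroup.cmDatum L 2 (Matrix.of fun i j : Fin 2 => if i.val + j.val + 1 = 2 then (1 : L) else 0)).Local v ⧸
            Subgroup.centralizer ({γ} : Set ((UnitaryGroup.cmDatum L 2 (Matrix.of fun i j : Fin 2 => if i.val + j.val + 1 = 2 then (1 : L) else 0)).Local v)))],
      ∃ (Ψ : (UnitaryGroup.cmDatum L 2 (Matrix.of fun i j : Fin 2 => if i.val + j.val + 1 = 2 then (1 : L) else 0)).Local v →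
            (UnitaryGroup.cmDatum L 2 (Matrix.of fun i j : Fin 2 => if i.val + j.val + 1 = 2 then (1 : L) else 0)).Local v)
        (U₀ : Set ((UnitaryGroup.cmDatum L 2 (Matrix.of fun i j : Fin 2 => if i.val + j.val + 1 = 2 then (1 : L) else 0)).Local v)) (q : ℂ)
        (a : ConjClasses ((UnitaryGroup.cmDatum L 2 (Matrix.of fun i j : Fin 2 => if i.val + j.val + 1 = 2 then (1 : L) else 0)).Local v) → ℕ),
        U₀ ∈ 𝓝 (1 : (UnitaryGroup.cmDatum L 2 (Matrix.of fun i j : Fin 2 => if i.val + j.val + 1 = 2 then (1 : L) else 0)).Local v) ∧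
        (∀ γ ∈ U₀, ∀ x : (UnitaryGroup.cmDatum L 2 (Matrix.of fun i j : Fin 2 => if i.val + j.val + 1 = 2 then (1 : L) else 0)).Local v, x * γ * x⁻¹ ∈ U₀) ∧
        (∀ γ ∈ U₀, ∀ x : (UnitaryGroup.cmDatum L 2 (Matrix.of fun i j : Fin 2 => if i.val + j.val + 1 = 2 then (1 : L) else 0)).Local v, Ψ (x * γ * x⁻¹) = x * Ψ γ * x⁻¹) ∧
        (∀ γ ∈ U₀, (∀ z : (UnitaryGroup.cmDatum L 2 (Matrix.of fun i j : Fin 2 => if i.val + j.val + 1 = 2 then (1 : L) else 0)).Local v, z * γ = γ * z ↔ z * Ψ γ = Ψ γ * z) ∧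
          Subgroup.centralizer ({Ψ γ} : Set ((UnitaryGroup.cmDatum L 2 (Matrix.of fun i j : Fin 2 => if i.val + j.val + 1 = 2 then (1 : L) else 0)).Local v)) =
            Subgroup.centralizer ({γ} : Set ((UnitaryGroup.cmDatum L 2 (Matrix.of fun i j : Fin 2 => if i.val + j.val + 1 = 2 then (1 : L) else 0)).Local v))) ∧
        (∀ γ ∈ U₀, IsRegularElt (γ.val : GL (Fin 2) (UnitaryGroup.LocalRing L v)) →
          IsRegularElt ((Ψ γ).val : GL (Fin 2) (UnitaryGroup.LocalRing L v))) ∧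
        (∀ γ ∈ U₀, Ψ γ ∈ U₀) ∧
        (∀ γ ∈ U₀, Tendsto (fun k : ℕ => Ψ^[k] γ) atTop (𝓝 (1 : (UnitaryGroup.cmDatum L 2 (Matrix.of fun i j : Fin 2 => if i.val + j.val + 1 = 2 then (1 : L) else 0)).Local v))) ∧
        (∀ F : (UnitaryGroup.cmDatum L 2 (Matrix.of fun i j : Fin 2 => if i.val + j.val + 1 = 2 then (1 : L) else 0)).Local v → ℂ, IsLocSmooth F → IsLocSmooth (U₀.indicator (F ∘ Ψ))) ∧
        1 < ‖q‖ ∧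
        (∀ u : ConjClasses ((UnitaryGroup.cmDatum L 2 (Matrix.of fun i j : Fin 2 => if i.val + j.val + 1 = 2 then (1 : L) else 0)).Local v), u ≠ ConjClasses.mk 1 → 1 ≤ a u) ∧
        ∀ (S : Finset (ConjClasses ((UnitaryGroup.cmDatum L 2 (Matrix.of fun i j : Fin 2 => if i.val + j.val + 1 = 2 then (1 : L) else 0)).Local v)))
          (mU : OrbitalMeasureFamily ((UnitaryGroup.cmDatum L 2 (Matrix.of fun i j : Fin 2 => if i.val + j.val + 1 = 2 then (1 : L) else 0)).Local v)),
          (∀ u ∈ S, (((Quotient.out u : (UnitaryGroup.cmDatum L 2 (Matrix.of fun i j : Fin 2 => if i.val + j.val + 1 = 2 then (1 : L) else 0)).Local v).val :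
              GL (Fin 2) (UnitaryGroup.LocalRing L v)).val - 1) ^ 2 = 0) →
          mU.IsAdmissibleOn (fun γ : (UnitaryGroup.cmDatum L 2 (Matrix.of fun i j : Fin 2 => if i.val + j.val + 1 = 2 then (1 : L) else 0)).Local v => (ConjClasses.mk γ) ∈ S) →
          ∀ u ∈ S, ∀ F : (UnitaryGroup.cmDatum L 2 (Matrix.of fun i j : Fin 2 => if i.val + j.val + 1 = 2 then (1 : L) else 0)).Local v → ℂ, IsLocSmooth F →
            classOrbitalIntegral mU (U₀.indicator (F ∘ Ψ)) u = q ^ (a u) * classOrbitalIntegral mU F u :=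
  psiPackage_of_scalingLaw_local_two hSC

end Summit.HodgeConjecture.HodgeConjecture.Cruxes.H413.K2E3CayleyScalingRankOnePackage

end
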